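import Literature.NumberTheory.LFunctions.FordProgram1Run33A
import Literature.NumberTheory.LFunctions.FordProgram1Run33B
import Literature.NumberTheory.LFunctions.FordProgram1Run33C
import HarnessLib

/-!
# Ford's "Program 1": kernel run 33 (`1040 ≤ k ≤ 1055`)

Topic `Literature/NumberTheory/LFunctions`. Everything here is PROVED (standard axioms):
`FordP1.checkT k = true` for `1040 ≤ k ≤ 1055`, i.e. the certified re-run of PROGRAM 1 of
K. Ford, Proc. LMS 85 (2002) (the second part of Theorem 3) for these `k` — see `FordProgram1.lean`
for the checker, its soundness `FordP1.row_of_checkK`, and the meaning of the constants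
(`ρ = FordP1.rhoOf k / 10⁵`, `θ = FordP1.thetaOf k / 10⁴`, `ω = FordP1.omOf k / 10⁴`). The kernel
evaluations themselves (one `decide +kernel` per `k`, so that the kernel's evaluation state is bounded
by a single run) live in `FordProgram1Run33A.lean` (`1040 ≤ k ≤ 1045`), `FordProgram1Run33B.lean`
(`1046 ≤ k ≤ 1051`) and `FordProgram1Run33C.lean` (`1052 ≤ k ≤ 1055`); this file only assembles
them into the `List.all` range statement `FordP1.run33` consumed by `FordTheorem3SmallK.lean`
(no kernel evaluation happens here).

## References

* K. Ford, Proc. London Math. Soc. (3) 85 (2002), 565–633; arXiv:1910.08209: Theorem 3, (1.7),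
  Lemmas 3.4–3.5, Appendix "PROGRAM 1". [Ford2002]
-/

namespace Literature.NumberTheory.LFunctions
namespace FordP1

/-- **Kernel run 33**: `checkT k` for `1040 ≤ k ≤ 1055` (assembled from `run33A`, `run33B`,
`run33C`). [cite: Ford2002, Theorem 3 (second part) and PROGRAM 1] -/
theorem run33 : ((List.range' 1040 16).all checkT) = true := by
  rw [List.all_eq_true]
  intro k hk
  obtain ⟨h1, h2⟩ := List.mem_range'_1.mp hk
  rcases lt_or_ge k 1046 with h | h
  · exact run33A k h1 (by omega)
  rcases lt_or_ge k 1052 with h' | h'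
  · exact run33B k h (by omega)
  · exact run33C k h' (by omega)

end FordP1
end Literature.NumberTheory.LFunctions
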